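import Literature.NumberTheory.Automorphic.AutomorphicMeasureGLDomain
import Literature.NumberTheory.Automorphic.RankinSelbergSiegelFiniteness
import Literature.NumberTheory.Automorphic.RatPointsCoveringWeights
import Literature.MeasureTheory.Group.CoveringWeights
import HarnessLib

/-!
# Domination of `GL_n(K)`-weighted integrals by a Siegel set, and dyadic shells in the centre

Topic `NumberTheory/Automorphic`; namespace `Literature.NumberTheory.Automorphic`. Two measure-theoretic
steps of the finiteness half of the real-point Rankin–Selberg method on `GL_n` in the covering-weight
form of the tree (`WhittakerTowerChain`: the top of the tower is `∫_G ‖φ‖² w β` with `β` a covering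
weight of a discrete group of rational points; Jacquet–Shalika (1981), §4; Cogdell (2004), §2.3,
p. 211 "converges absolutely for all `s` away from the poles"):

* `lintegral_mul_weight_le_setLIntegral_of_cover` — **domination by a covering set**: if
  `GL_n(K) · 𝔖' = GL_n(𝔸_K)` then `∫_G F β dν ≤ ∫_{𝔖'} F dν` for every measurable `F ≥ 0` left
  `GL_n(K)`-invariant and every `GL_n(K)`-covering weight `β` (the covering sum of `𝟙_{𝔖'}` is `≥ 1`;
  `lintegral_mul_le_inv_mul_setLIntegral_of_le_coveringSum_indicator` of `CoveringWeights`); with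
  reduction theory (`reductionTheory_gl_holds`: `GL_n(K) · A_G · 𝔖 = G` for a Siegel set `𝔖`) the set is
  `𝔖' = A_G 𝔖` (`lintegral_mul_weight_le_setLIntegral_center_mul_siegel`);
* `scalarExp t = z(e^t) ∈ A_G`, the **dyadic shells** `shell S₀ j = z(e^{[j,j+1]}) S₀` of `A_G S₀`, and
  `setLIntegral_center_mul_le_tsum_mul` — **for `P ≥ 0` invariant under `A_G` and `Q ≥ 0` with
  `Q(z(e^t) s) ≤ ε_j` on the `j`-th shell, `∫_{A_G S₀} P Q dν ≤ (Σ_j ε_j) ∫_{shell S₀ 0} P dν`** (the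
  shells cover, `Q ≤ ε_j` on the `j`-th, and `∫_{shell j} P = ∫_{shell 0} P` by left invariance of `ν`
  and `A_G`-invariance of `P`). For the Rankin–Selberg integrand `P = ‖φ‖²` (invariant under the
  centre) and `Q(g) = |det g|^σ Σ_{ξ ≠ 0} Φ(ξ g)` (decaying in both directions of `A_G`).
* `measurableSet_shell_siegel`, `measurableSet_range_scalarExp_mul_siegel` — the shells of a Siegel set
  and `A_G 𝔖` are Borel (`measurableSet_mul_siegelSet` of `RankinSelbergSiegelFiniteness`).

Everything is proved.

## References

* H. Jacquet, J. A. Shalika, Amer. J. Math. 103 (1981), §4 [JacquetShalikaAJM1981].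
* J. W. Cogdell, in *An Introduction to the Langlands Program* (2004), §2.3 [CogdellAnalyticTheory2004].
-/

noncomputable section

open MeasureTheory Measure NumberField IsDedekindDomain Matrix Set Filter Topology
open scoped MatrixGroups ENNReal NNReal Pointwise

namespace Literature.NumberTheory.Automorphic

/-! ### Domination by a covering set -/

section Cover

variable {n : ℕ} {K : Type} [Field K] [NumberField K]

/-- `rationalPointsGL n K = ratPoints ⊤` (both are the image of `GL_n(K) → GL_n(𝔸_K)`). [folklore] -/
theorem rationalPointsGL_eq_ratPoints_top :
    rationalPointsGL n K = ratPoints (⊤ : Subgroup (GL (Fin n) K)) := by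
  rw [rationalPointsGL, ratPoints, MonoidHom.range_eq_map]

variable [MeasurableSpace (GL (Fin n) (AdeleRing (𝓞 K) K))] [BorelSpace (GL (Fin n) (AdeleRing (𝓞 K) K))]

/-- **Domination by a covering set.** If every `x ∈ GL_n(𝔸_K)` has a rational translate in the
measurable set `𝔖'`, then for `F ≥ 0` measurable and left `GL_n(K)`-invariant, `ν` left invariant and
`β` a `GL_n(K)`-covering weight, `∫ F β dν ≤ ∫_{𝔖'} F dν`. [folklore] -/
theorem lintegral_mul_weight_le_setLIntegral_of_cover (ν : Measure (GL (Fin n) (AdeleRing (𝓞 K) K)))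
    [ν.IsMulLeftInvariant] [SFinite ν] {𝔖' : Set (GL (Fin n) (AdeleRing (𝓞 K) K))} (h𝔖 : MeasurableSet 𝔖')
    (hcover : ∀ x : GL (Fin n) (AdeleRing (𝓞 K) K), ∃ γ₀ : GL (Fin n) K,
      Matrix.GeneralLinearGroup.map (algebraMap K (AdeleRing (𝓞 K) K)) γ₀ * x ∈ 𝔖')
    {F : GL (Fin n) (AdeleRing (𝓞 K) K) → ℝ≥0∞} (hF : Measurable F)
    (hFK : ∀ (γ₀ : GL (Fin n) K) (x : GL (Fin n) (AdeleRing (𝓞 K) K)),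
      F (Matrix.GeneralLinearGroup.map (algebraMap K (AdeleRing (𝓞 K) K)) γ₀ * x) = F x)
    {β : GL (Fin n) (AdeleRing (𝓞 K) K) → ℝ≥0∞} (hβm : Measurable β)
    (hβ : ∀ x, Literature.MeasureTheory.Group.coveringSum ↥(ratPoints (⊤ : Subgroup (GL (Fin n) K))) β x = 1) :
    ∫⁻ x, F x * β x ∂ν ≤ ∫⁻ x in 𝔖', F x ∂ν := by
  haveI := secondCountableTopology_generalLinearGroup_adeleRing K (Fin n)
  have hFinv : ∀ (γ : ↥(ratPoints (⊤ : Subgroup (GL (Fin n) K)))) (x : GL (Fin n) (AdeleRing (𝓞 K) K)),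
      F (γ • x) = F x := by
    rintro ⟨γ, hγ⟩ x
    obtain ⟨γ₀, -, rfl⟩ := hγ
    exact hFK γ₀ x
  have hcov : ∀ x, (1 : ℝ≥0∞) ≤
      Literature.MeasureTheory.Group.coveringSum ↥(ratPoints (⊤ : Subgroup (GL (Fin n) K))) (𝔖'.indicator 1) x := by
    intro x
    obtain ⟨γ₀, hγ₀⟩ := hcover x
    have hmem : Matrix.GeneralLinearGroup.map (algebraMap K (AdeleRing (𝓞 K) K)) γ₀ ∈
        ratPoints (⊤ : Subgroup (GL (Fin n) K)) := ⟨γ₀, Subgroup.mem_top _, rfl⟩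
    calc (1 : ℝ≥0∞) = 𝔖'.indicator 1 ((⟨_, hmem⟩ : ↥(ratPoints (⊤ : Subgroup (GL (Fin n) K)))) • x) := by
          rw [Set.indicator_of_mem (show ((⟨_, hmem⟩ : ↥(ratPoints (⊤ : Subgroup (GL (Fin n) K)))) • x) ∈ 𝔖' from hγ₀)]
          rfl
      _ ≤ _ := ENNReal.le_tsum (f := fun γ : ↥(ratPoints (⊤ : Subgroup (GL (Fin n) K))) => 𝔖'.indicator 1 (γ • x)) ⟨_, hmem⟩
  have h := Literature.MeasureTheory.Group.lintegral_mul_le_inv_mul_setLIntegral_of_le_coveringSum_indicator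
    (Γ := ↥(ratPoints (⊤ : Subgroup (GL (Fin n) K)))) (ν := ν) hF hFinv hβm (fun x => (hβ x).le) h𝔖 one_ne_zero
    ENNReal.one_ne_top hcov
  simpa only [inv_one, one_mul] using h

end Cover

/-! ### The centre `A_G` in logarithmic coordinates and the dyadic shells -/

section Shells

variable {n : ℕ} {K : Type} [Field K] [NumberField K]

variable (n K) in
/-- `z(e^t) ∈ A_G`: the positive real scalar matrix with parameter `e^t`. [folklore] -/
def scalarExp (t : ℝ) : GL (Fin n) (AdeleRing (𝓞 K) K) := posRealScalar n K (expUnitNNReal t)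

/-- `z(e^{s+t}) = z(e^s) z(e^t)`. [folklore] -/
theorem scalarExp_add (s t : ℝ) : scalarExp n K (s + t) = scalarExp n K s * scalarExp n K t := by
  rw [scalarExp, expUnitNNReal_add, map_mul]; rfl

/-- `z(e^0) = 1`. [folklore] -/
theorem scalarExp_zero : scalarExp n K 0 = 1 := by
  rw [scalarExp, expUnitNNReal_zero, map_one]

/-- `t ↦ z(e^t)` is continuous. [folklore] -/
theorem continuous_scalarExp : Continuous (scalarExp n K) := continuous_posRealScalar_expUnitNNReal n K

/-- `z(e^t)` is central. [folklore] -/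
theorem scalarExp_mul_comm (t : ℝ) (g : GL (Fin n) (AdeleRing (𝓞 K) K)) : scalarExp n K t * g = g * scalarExp n K t :=
  ((Subgroup.mem_center_iff.1 (posRealScalar_mem_center n K (expUnitNNReal t))) g).symm

/-- Every positive real unit is `e^t`. [folklore] -/
theorem exists_expUnitNNReal_eq (r : ℝ≥0ˣ) : ∃ t : ℝ, expUnitNNReal t = r := by
  have hr : (0 : ℝ) < ((r : ℝ≥0) : ℝ) := NNReal.coe_pos.2 (pos_iff_ne_zero.2 r.ne_zero)
  refine ⟨Real.log ((r : ℝ≥0) : ℝ), Units.ext (NNReal.eq ?_)⟩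
  rw [coe_expUnitNNReal, Real.exp_log hr]

/-- `A_G = {z(e^t)}`: the range of `scalarExp` is the range of `posRealScalar`. [folklore] -/
theorem range_scalarExp : Set.range (scalarExp n K) = Set.range (posRealScalar n K) := by
  ext g
  constructor
  · rintro ⟨t, rfl⟩; exact ⟨_, rfl⟩
  · rintro ⟨r, rfl⟩
    obtain ⟨t, ht⟩ := exists_expUnitNNReal_eq r
    exact ⟨t, by rw [scalarExp, ht]⟩

variable (n K) in
/-- **The `j`-th dyadic shell** of `A_G S₀`: `{z(e^t) s : t ∈ [j, j+1], s ∈ S₀}`. [folklore] -/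
def shell (S₀ : Set (GL (Fin n) (AdeleRing (𝓞 K) K))) (j : ℤ) : Set (GL (Fin n) (AdeleRing (𝓞 K) K)) :=
  (fun p : ℝ × GL (Fin n) (AdeleRing (𝓞 K) K) => scalarExp n K p.1 * p.2) '' (Icc (j : ℝ) (j + 1) ×ˢ S₀)

/-- The shell as a pointwise product `z(e^{[j,j+1]}) · S₀`. [folklore] -/
theorem shell_eq_image_mul (S₀ : Set (GL (Fin n) (AdeleRing (𝓞 K) K))) (j : ℤ) :
    shell n K S₀ j = scalarExp n K '' Icc (j : ℝ) (j + 1) * S₀ := by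
  ext g
  simp only [shell, Set.mem_image, Set.mem_prod, Set.mem_mul, Prod.exists]
  constructor
  · rintro ⟨t, s, ⟨ht, hs⟩, rfl⟩
    exact ⟨_, ⟨t, ht, rfl⟩, s, hs, rfl⟩
  · rintro ⟨_, ⟨t, ht, rfl⟩, s, hs, rfl⟩
    exact ⟨t, s, ⟨ht, hs⟩, rfl⟩

/-- **The shells are translates of one another**: `shell j = z(e^j) · shell 0`. [folklore] -/
theorem shell_eq_image_mul_left (S₀ : Set (GL (Fin n) (AdeleRing (𝓞 K) K))) (j : ℤ) :
    shell n K S₀ j = (fun g => scalarExp n K j * g) '' shell n K S₀ 0 := by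
  ext g
  simp only [shell, Set.mem_image, Set.mem_prod, Prod.exists, Int.cast_zero, zero_add]
  constructor
  · rintro ⟨t, s, ⟨ht, hs⟩, rfl⟩
    refine ⟨scalarExp n K (t - j) * s, ⟨t - j, s, ⟨⟨by linarith [ht.1], by linarith [ht.2]⟩, hs⟩, rfl⟩, ?_⟩
    rw [← mul_assoc, ← scalarExp_add]
    congr 2; ring
  · rintro ⟨_, ⟨t, s, ⟨ht, hs⟩, rfl⟩, rfl⟩
    refine ⟨j + t, s, ⟨⟨by linarith [ht.1], by linarith [ht.2]⟩, hs⟩, ?_⟩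
    rw [← mul_assoc, ← scalarExp_add]

/-- **The shells cover `A_G S₀`.** [folklore] -/
theorem range_mul_subset_iUnion_shell (S₀ : Set (GL (Fin n) (AdeleRing (𝓞 K) K))) :
    Set.range (scalarExp n K) * S₀ ⊆ ⋃ j : ℤ, shell n K S₀ j := by
  rintro g ⟨_, ⟨t, rfl⟩, s, hs, rfl⟩
  refine Set.mem_iUnion.2 ⟨⌊t⌋, ⟨(t, s), ⟨⟨Int.floor_le t, (Int.lt_floor_add_one t).le⟩, hs⟩, rfl⟩⟩

variable [MeasurableSpace (GL (Fin n) (AdeleRing (𝓞 K) K))] [BorelSpace (GL (Fin n) (AdeleRing (𝓞 K) K))]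

/-- **Left invariance on a shell**: `∫_{shell j} P dν = ∫_{shell 0} P dν` for `P` invariant under
`z(e^j)` and `ν` left invariant. [folklore] -/
theorem setLIntegral_shell_eq (ν : Measure (GL (Fin n) (AdeleRing (𝓞 K) K))) [ν.IsMulLeftInvariant]
    (S₀ : Set (GL (Fin n) (AdeleRing (𝓞 K) K))) {P : GL (Fin n) (AdeleRing (𝓞 K) K) → ℝ≥0∞}
    (hP : ∀ (t : ℝ) (g : GL (Fin n) (AdeleRing (𝓞 K) K)), P (scalarExp n K t * g) = P g) (j : ℤ) :
    ∫⁻ g in shell n K S₀ j, P g ∂ν = ∫⁻ g in shell n K S₀ 0, P g ∂ν := by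
  haveI : MeasurableMul (GL (Fin n) (AdeleRing (𝓞 K) K)) := by
    haveI := secondCountableTopology_generalLinearGroup_adeleRing K (Fin n)
    infer_instance
  have h := (measurePreserving_mul_left ν (scalarExp n K j)).setLIntegral_comp_preimage_emb
    (measurableEmbedding_mulLeft (scalarExp n K j)) P (shell n K S₀ j)
  rw [← h, shell_eq_image_mul_left S₀ j, Set.preimage_image_eq _ (mul_right_injective (scalarExp n K (j : ℝ)))]
  exact lintegral_congr fun g => hP _ g

/-- **Dyadic shells in the centre.** Let `P ≥ 0` be measurable and invariant under `A_G`, and let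
`Q ≥ 0` satisfy `Q(z(e^t) s) ≤ ε j` for `t ∈ [j, j+1]`, `s ∈ S₀` (all `j ∈ ℤ`), the shells being
measurable. Then

  `∫_{A_G S₀} P Q dν ≤ (Σ_{j ∈ ℤ} ε j) · ∫_{shell S₀ 0} P dν`

(the shells cover `A_G S₀`; on the `j`-th, `P Q ≤ ε_j P`; `∫_{shell j} P = ∫_{shell 0} P`). [folklore] -/
theorem setLIntegral_center_mul_le_tsum_mul (ν : Measure (GL (Fin n) (AdeleRing (𝓞 K) K))) [ν.IsMulLeftInvariant]
    {S₀ : Set (GL (Fin n) (AdeleRing (𝓞 K) K))} (hS : ∀ j : ℤ, MeasurableSet (shell n K S₀ j))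
    {P Q : GL (Fin n) (AdeleRing (𝓞 K) K) → ℝ≥0∞} (hPm : Measurable P)
    (hP : ∀ (t : ℝ) (g : GL (Fin n) (AdeleRing (𝓞 K) K)), P (scalarExp n K t * g) = P g)
    {ε : ℤ → ℝ≥0∞} (hQ : ∀ (j : ℤ) (t : ℝ), t ∈ Icc (j : ℝ) (j + 1) → ∀ s ∈ S₀, Q (scalarExp n K t * s) ≤ ε j) :
    ∫⁻ g in Set.range (scalarExp n K) * S₀, P g * Q g ∂ν ≤ (∑' j : ℤ, ε j) * ∫⁻ g in shell n K S₀ 0, P g ∂ν := by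
  calc ∫⁻ g in Set.range (scalarExp n K) * S₀, P g * Q g ∂ν
      ≤ ∫⁻ g in ⋃ j : ℤ, shell n K S₀ j, P g * Q g ∂ν := lintegral_mono_set (range_mul_subset_iUnion_shell S₀)
    _ ≤ ∑' j : ℤ, ∫⁻ g in shell n K S₀ j, P g * Q g ∂ν := lintegral_iUnion_le _ _
    _ ≤ ∑' j : ℤ, ε j * ∫⁻ g in shell n K S₀ 0, P g ∂ν := ENNReal.tsum_le_tsum fun j => ?_
    _ = (∑' j : ℤ, ε j) * ∫⁻ g in shell n K S₀ 0, P g ∂ν := ENNReal.tsum_mul_right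
  -- on the `j`-th shell `P Q ≤ ε_j P`
  calc ∫⁻ g in shell n K S₀ j, P g * Q g ∂ν
      ≤ ∫⁻ g in shell n K S₀ j, P g * ε j ∂ν := by
        refine setLIntegral_mono' (hS j) fun g hg => ?_
        obtain ⟨⟨t, s⟩, ⟨ht, hs⟩, rfl⟩ := hg
        exact mul_le_mul_right (hQ j t ht s hs) _
    _ = ε j * ∫⁻ g in shell n K S₀ j, P g ∂ν := by rw [lintegral_mul_const _ hPm, mul_comm]
    _ = ε j * ∫⁻ g in shell n K S₀ 0, P g ∂ν := by rw [setLIntegral_shell_eq ν S₀ hP j]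

/-! ### Siegel sets: measurability of the shells and domination by `A_G 𝔖` -/

/-- The shells of a Siegel set `Ω A_{T₀}(t) K` are Borel (`measurableSet_mul_siegelSet` with the compact
central piece `z(e^{[j,j+1]})`). [folklore] -/
theorem measurableSet_shell_siegel {Ω : Set (GL (Fin n) (AdeleRing (𝓞 K) K))} (hΩc : IsCompact Ω) {t : ℝ}
    (ht : 0 < t) (j : ℤ) :
    MeasurableSet (shell n K (Ω * siegelCone n K t *
      (standardMaximalCompactGL n K : Set (GL (Fin n) (AdeleRing (𝓞 K) K)))) j) := by
  rw [shell_eq_image_mul]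
  exact measurableSet_mul_siegelSet n K (isCompact_Icc.image continuous_scalarExp) hΩc ht

/-- `A_G · (Ω A_{T₀}(t) K)` is Borel (a countable union of shells). [folklore] -/
theorem measurableSet_range_scalarExp_mul_siegel {Ω : Set (GL (Fin n) (AdeleRing (𝓞 K) K))} (hΩc : IsCompact Ω)
    {t : ℝ} (ht : 0 < t) :
    MeasurableSet (Set.range (scalarExp n K) * (Ω * siegelCone n K t *
      (standardMaximalCompactGL n K : Set (GL (Fin n) (AdeleRing (𝓞 K) K))))) := by
  have heq : Set.range (scalarExp n K) * (Ω * siegelCone n K t *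
      (standardMaximalCompactGL n K : Set (GL (Fin n) (AdeleRing (𝓞 K) K)))) =
      ⋃ j : ℤ, shell n K (Ω * siegelCone n K t *
        (standardMaximalCompactGL n K : Set (GL (Fin n) (AdeleRing (𝓞 K) K)))) j := by
    refine Set.Subset.antisymm (range_mul_subset_iUnion_shell _) (Set.iUnion_subset fun j => ?_)
    rintro g ⟨⟨t', s⟩, ⟨-, hs⟩, rfl⟩
    exact ⟨_, ⟨t', rfl⟩, s, hs, rfl⟩
  rw [heq]
  exact MeasurableSet.iUnion fun j => measurableSet_shell_siegel hΩc ht j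

/-- **Domination by `A_G 𝔖`** (reduction theory): for the Siegel set `𝔖` of `reductionTheory_gl_holds`
(`GL_n(K) · A_G · 𝔖 = GL_n(𝔸_K)`), every left `GL_n(K)`-invariant measurable `F ≥ 0` and every
`GL_n(K)`-covering weight `β` satisfy `∫ F β dν ≤ ∫_{A_G 𝔖} F dν`; here `𝔖 = Ω A_{T₀}(t) K` is given by
its data. [folklore] -/
theorem lintegral_mul_weight_le_setLIntegral_center_mul_siegel (ν : Measure (GL (Fin n) (AdeleRing (𝓞 K) K)))
    [ν.IsMulLeftInvariant] [SFinite ν] {Ω : Set (GL (Fin n) (AdeleRing (𝓞 K) K))} (hΩc : IsCompact (closure Ω))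
    {t : ℝ} (ht : 0 < t)
    (hred : (rationalPointsGL n K : Set (GL (Fin n) (AdeleRing (𝓞 K) K))) *
        ((posRealScalar n K).range : Set (GL (Fin n) (AdeleRing (𝓞 K) K))) *
          (Ω * siegelCone n K t * (standardMaximalCompactGL n K : Set (GL (Fin n) (AdeleRing (𝓞 K) K)))) =
      Set.univ)
    {F : GL (Fin n) (AdeleRing (𝓞 K) K) → ℝ≥0∞} (hF : Measurable F)
    (hFK : ∀ (γ₀ : GL (Fin n) K) (x : GL (Fin n) (AdeleRing (𝓞 K) K)),
      F (Matrix.GeneralLinearGroup.map (algebraMap K (AdeleRing (𝓞 K) K)) γ₀ * x) = F x)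
    {β : GL (Fin n) (AdeleRing (𝓞 K) K) → ℝ≥0∞} (hβm : Measurable β)
    (hβ : ∀ x, Literature.MeasureTheory.Group.coveringSum ↥(ratPoints (⊤ : Subgroup (GL (Fin n) K))) β x = 1) :
    ∫⁻ x, F x * β x ∂ν ≤ ∫⁻ x in Set.range (scalarExp n K) * (closure Ω * siegelCone n K t *
      (standardMaximalCompactGL n K : Set (GL (Fin n) (AdeleRing (𝓞 K) K)))), F x ∂ν := by
  refine lintegral_mul_weight_le_setLIntegral_of_cover ν (measurableSet_range_scalarExp_mul_siegel hΩc ht)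
    (fun x => ?_) hF hFK hβm hβ
  have hx : x ∈ (rationalPointsGL n K : Set (GL (Fin n) (AdeleRing (𝓞 K) K))) *
      ((posRealScalar n K).range : Set (GL (Fin n) (AdeleRing (𝓞 K) K))) *
        (Ω * siegelCone n K t * (standardMaximalCompactGL n K : Set (GL (Fin n) (AdeleRing (𝓞 K) K)))) := by
    rw [hred]; exact Set.mem_univ x
  obtain ⟨_, ⟨γ, ⟨γ₀, rfl⟩, z, ⟨r, rfl⟩, rfl⟩, s, hs, rfl⟩ := hx
  refine ⟨γ₀⁻¹, ?_⟩
  have hcalc : Matrix.GeneralLinearGroup.map (algebraMap K (AdeleRing (𝓞 K) K)) γ₀⁻¹ *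
      (Matrix.GeneralLinearGroup.map (algebraMap K (AdeleRing (𝓞 K) K)) γ₀ * posRealScalar n K r * s) =
      posRealScalar n K r * s := by
    rw [map_inv]; group
  simp only []
  rw [hcalc]
  refine Set.mul_mem_mul ?_ (Set.mul_subset_mul_right (Set.mul_subset_mul_right subset_closure) hs)
  rw [range_scalarExp]; exact ⟨r, rfl⟩

end Shells

end Literature.NumberTheory.Automorphic
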